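import Literature.RingTheory.FittingIdeal.QuotientRing
import Summits.BirchSwinnertonDyer.BirchSwinnertonDyer.Theorems.CumulativeHeegnerLeopoldtCumulativeHeegnerInclusionAtThreeLayerTowerControl
import HarnessLib

/-!
# Crux K1 `CumulativeHeegnerInclusionAtThree` (stmt-BirchSwinnertonDyer-24198) — the layer door in
# EQUIVARIANT currency: a Fitting membership over `Λ ⧸ (ω_m) = ℤ_p[Γ/Γ_m]` at every layer gives (LT)

Width seat bsd-line-chl-k1-p1-w7 g0 (`--supports stmt-BirchSwinnertonDyer-24198`), lane [P-ctl] (c4). THEOREMS ONLY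
(no definition, no named fact, no `sorry`); ROUTE-INDEPENDENT; pure commutative algebra. Nothing here proves the
crux K1, its research stub A (stmt-26896) or any summit statement; BSD is not proved by any of this.

## What

The module-level layer door `…LayerTowerControl.mul_mem_map_fittingIdeal_sup_of_layerData` (p637962) reads a
layer element `θ ∈ Fitt₀^R(N)·S` for an `R`-module `N` sitting in an exact `C → X ⧸ ωX → N → 0`. A layer-`m`
argument of Mazur–Tate / Kurihara / Kim–Kurihara shape, however, delivers its output over the GROUP RING of the
layer, `Λ ⧸ (ω_m) = ℤ_p[Γ/Γ_m]` (`ω_m = (1+T)^{p^m} − 1`): a membership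
`θ̄_m ∈ Fitt₀^{Λ/(ω_m)}(X ⧸ ω_m X)` of the `Λ ⧸ (ω_m)`-module `X ⧸ ω_m X` (which, under layer control, is the
Pontryagin dual of the layer-`m` Selmer group: `…LayerDual`, p649929). This file records that this EQUIVARIANT
currency enters (LT) with no loss, via the tree's `Module.mk_mem_fittingIdeal_quotient_iff`
(`Literature/RingTheory/FittingIdeal/QuotientRing.lean`: `θ mod I ∈ Fitt^{R/I}(M ⧸ IM) ↔ θ ∈ Fitt^R(M) + I`,
Stacks 07ZA (3) for `R' = R/I`):

* `mul_mem_map_fittingIdeal_sup_of_quotientFitting` — one layer, any `φ : R → S`, any finite `R`-module `X`,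
  any `ω ∈ R` with `φ ω ∈ 𝔟`: `θ mod (ω) ∈ Fitt₀^{R/(ω)}(X ⧸ ωX)` and `t·L ∈ (φ θ) + 𝔟` give
  `t·L ∈ Fitt₀^R(X)·S + 𝔟`;
* **`forall_pow_mul_mem_map_fittingIdeal_sup_layer_of_quotientFitting`** — the tower over
  `Λ = ℤ_p⟦T⟧ → R₀⟦T⟧` (`toUnr`, any prime `p`): layer elements `θ_m ∈ Λ` with
  `θ̄_m ∈ Fitt₀^{Λ/(ω_m)}(Y ⧸ ω_m Y)` and layer congruences `p^μ · L ∈ (φ θ_m) + (p^m) + (ω_m)` for all `m` give,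
  for every `m`, `p^μ · L ∈ Fitt₀(Y)·R₀⟦T⟧ + (p^m) + (ω_m)` — hypothesis (LT) of
  `…LayerTower.temperedHeegnerInclusionAtThree_of_fittingLayerTower` with exponent EXACTLY `μ`.

Nothing about the existence of such `θ_m` (the research stubs [R-layer-KS] / [R-layer-rec] of the census) is
asserted. References: [StacksProject] Tag 07ZA; [MazurTate1987] §1; [KimKurihara2021] §1.
-/

noncomputable section

-- every declaration of this file lives in the doubled summit namespace `Summit.BirchSwinnertonDyer.BirchSwinnertonDyer…`
set_option linter.dupNamespace false

namespace Summit.BirchSwinnertonDyer.BirchSwinnertonDyer.Theorems.CumulativeHeegnerInclusionAtThreeLayerFitting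

open Literature.RingTheory.FittingIdeal
open Summit.BirchSwinnertonDyer.BirchSwinnertonDyer.Theorems.CumulativeHeegnerInclusionAtThreeLayerTowerControl

universe u u' v

variable {R : Type u} [CommRing R] {S : Type u'} [CommRing S] (φ : R →+* S)
  {X : Type v} [AddCommGroup X] [Module R X] [Module.Finite R X]

/-- **The layer door in equivariant currency, one layer.** For `φ : R → S`, a finite `R`-module `X`, `ω ∈ R`
with `φ ω ∈ 𝔟`, an element `θ ∈ R` whose residue lies in `Fitt₀^{R/(ω)}(X ⧸ ωX)` (the Fitting ideal of the
`R ⧸ (ω)`-module `X ⧸ ωX`) and a congruence `t · L ∈ (φ θ) + 𝔟`: then `t · L ∈ Fitt₀^R(X)·S + 𝔟` — since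
`θ ∈ Fitt₀^R(X) + (ω)` (`Module.mk_mem_fittingIdeal_quotient_iff`, Stacks 07ZA (3)).
[cite: StacksProject, Tag 07ZA] [cite: MazurTate1987, §1] -/
theorem mul_mem_map_fittingIdeal_sup_of_quotientFitting (ω : R) {𝔟 : Ideal S} (hω : φ ω ∈ 𝔟) {θ : R}
    {t L : S}
    (hθ : Ideal.Quotient.mk (Ideal.span {ω}) θ ∈
      Module.fittingIdeal (R ⧸ Ideal.span {ω}) (X ⧸ (Ideal.span {ω} • ⊤ : Submodule R X)) 0)
    (hrec : t * L ∈ Ideal.span {φ θ} ⊔ 𝔟) :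
    t * L ∈ (Module.fittingIdeal R X 0).map φ ⊔ 𝔟 := by
  -- `θ ∈ Fitt₀(X) + (ω)`, so `φ θ ∈ Fitt₀(X)·S + 𝔟`
  have hθ' : θ ∈ Module.fittingIdeal R X 0 ⊔ Ideal.span {ω} :=
    (Module.mk_mem_fittingIdeal_quotient_iff (Ideal.span {ω}) 0 θ).mp hθ
  have hφθ : φ θ ∈ (Module.fittingIdeal R X 0).map φ ⊔ 𝔟 := by
    obtain ⟨a, ha, b, hb, hab⟩ := Submodule.mem_sup.mp hθ'
    obtain ⟨r, rfl⟩ := Ideal.mem_span_singleton'.mp hb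
    rw [← hab, map_add, map_mul]
    exact Ideal.add_mem _ (Ideal.mem_sup_left (Ideal.mem_map_of_mem φ ha))
      (Ideal.mem_sup_right (Ideal.mul_mem_left _ _ hω))
  -- `t · L = r · φ θ + b`
  obtain ⟨y, hy, b, hb, hyb⟩ := Submodule.mem_sup.mp hrec
  obtain ⟨r, rfl⟩ := Ideal.mem_span_singleton'.mp hy
  rw [← hyb]
  exact Ideal.add_mem _ (Ideal.mul_mem_left _ r hφθ) (Ideal.mem_sup_right hb)

/-- **Tower form** (any `φ : R → S`, layer elements `ω_m ∈ R`, ideals `𝔟_m ∋ φ ω_m`): residues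
`θ̄_m ∈ Fitt₀^{R/(ω_m)}(X ⧸ ω_m X)` and congruences `t · L ∈ (φ θ_m) + 𝔟_m` at every `m` give
`t · L ∈ Fitt₀^R(X)·S + 𝔟_m` at every `m`. [cite: StacksProject, Tag 07ZA] [cite: MazurTate1987, §1] -/
theorem forall_mul_mem_map_fittingIdeal_sup_of_quotientFitting (ω : ℕ → R) (𝔟 : ℕ → Ideal S)
    (hω : ∀ m, φ (ω m) ∈ 𝔟 m) (θ : ℕ → R) {t L : S}
    (hθ : ∀ m, Ideal.Quotient.mk (Ideal.span {ω m}) (θ m) ∈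
      Module.fittingIdeal (R ⧸ Ideal.span {ω m}) (X ⧸ (Ideal.span {ω m} • ⊤ : Submodule R X)) 0)
    (hrec : ∀ m, t * L ∈ Ideal.span {φ (θ m)} ⊔ 𝔟 m) (m : ℕ) :
    t * L ∈ (Module.fittingIdeal R X 0).map φ ⊔ 𝔟 m :=
  mul_mem_map_fittingIdeal_sup_of_quotientFitting φ (ω m) (hω m) (hθ m) (hrec m)

/-! ### The instance over `Λ = ℤ_p⟦T⟧ → R₀⟦T⟧` -/

section Unr

open Literature.NumberTheory.EllipticCurves Summit.BirchSwinnertonDyer.Rank1Residual.X11b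

variable {p : ℕ} [Fact p.Prime] {Y : Type v} [AddCommGroup Y] [Module (IwasawaAlgebra p) Y]
  [Module.Finite (IwasawaAlgebra p) Y]

/-- **The layer door over `Λ → R₀⟦T⟧` in EQUIVARIANT currency, in the currency of (LT).** For a finite
`Λ = ℤ_p⟦T⟧`-module `Y` (intended `X_{∅,0}(𝔭′) = X_ac^Σ`, whose layer quotients `Y ⧸ ω_m Y` are the Pontryagin
duals of the layer Selmer groups under control — `…LayerDual`): layer elements `θ_m ∈ Λ` with residues
`θ̄_m ∈ Fitt₀^{Λ/(ω_m)}(Y ⧸ ω_m Y)` (`Λ ⧸ (ω_m) = ℤ_p[Γ/Γ_m]`, `ω_m = (1+T)^{p^m} − 1` — the natural output of a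
Mazur–Tate / Kurihara-type argument at layer `m`) and layer congruences `p^μ · L ∈ (φ θ_m) + (p^m) + (ω_m)` in
`R₀⟦T⟧` give, for every `m`, `p^μ · L ∈ Fitt₀(Y)·R₀⟦T⟧ + (p^m) + (ω_m)` — hypothesis (LT) of
`…LayerTower.temperedHeegnerInclusionAtThree_of_fittingLayerTower` with exponent exactly `μ`. Nothing about the
existence of the `θ_m` is asserted. [cite: MazurTate1987, §1] [cite: KimKurihara2021, §1] [cite: StacksProject, Tag 07ZA] -/
theorem forall_pow_mul_mem_map_fittingIdeal_sup_layer_of_quotientFitting (μ : ℕ) (θ : ℕ → IwasawaAlgebra p)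
    {L : UnrSeries p}
    (hθ : ∀ m, Ideal.Quotient.mk (Ideal.span {((1 + PowerSeries.X) ^ (p ^ m) - 1 : IwasawaAlgebra p)}) (θ m) ∈
      Module.fittingIdeal (IwasawaAlgebra p ⧸ Ideal.span {((1 + PowerSeries.X) ^ (p ^ m) - 1 : IwasawaAlgebra p)})
        (Y ⧸ (Ideal.span {((1 + PowerSeries.X) ^ (p ^ m) - 1 : IwasawaAlgebra p)} •
          (⊤ : Submodule (IwasawaAlgebra p) Y))) 0)
    (hrec : ∀ m, ((p : ℕ) : UnrSeries p) ^ μ * L ∈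
      Ideal.span {PowerSeries.map (Halves.toUnr p) (θ m)} ⊔
        Ideal.span {((p : ℕ) : UnrSeries p) ^ m} ⊔
          Ideal.span {((1 + PowerSeries.X) ^ (p ^ m) - 1 : UnrSeries p)}) (m : ℕ) :
    ((p : ℕ) : UnrSeries p) ^ μ * L ∈
      (Module.fittingIdeal (IwasawaAlgebra p) Y 0).map (PowerSeries.map (Halves.toUnr p)) ⊔
        Ideal.span {((p : ℕ) : UnrSeries p) ^ m} ⊔
          Ideal.span {((1 + PowerSeries.X) ^ (p ^ m) - 1 : UnrSeries p)} := by
  have h := forall_mul_mem_map_fittingIdeal_sup_of_quotientFitting (PowerSeries.map (Halves.toUnr p))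
    (X := Y) (fun m ↦ ((1 + PowerSeries.X) ^ (p ^ m) - 1 : IwasawaAlgebra p))
    (fun m ↦ Ideal.span {((p : ℕ) : UnrSeries p) ^ m} ⊔
      Ideal.span {((1 + PowerSeries.X) ^ (p ^ m) - 1 : UnrSeries p)})
    (fun m ↦ by
      rw [map_toUnr_omega]
      exact Ideal.mem_sup_right (Ideal.mem_span_singleton_self _))
    θ (t := ((p : ℕ) : UnrSeries p) ^ μ) (L := L) hθ (fun m ↦ by simpa only [sup_assoc] using hrec m) m
  simpa only [sup_assoc] using h

end Unr

end Summit.BirchSwinnertonDyer.BirchSwinnertonDyer.Theorems.CumulativeHeegnerInclusionAtThreeLayerFitting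

end
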